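import Literature.AlgebraicGeometry.HodgeTheory.GlobalInvariantCyclesProofs
import Literature.AlgebraicGeometry.HodgeTheory.GysinKernelWeights
import Literature.AlgebraicTopology.SingularHomology.KroneckerDualMap
import Literature.AlgebraicTopology.SingularHomology.LocalHomologyCoeffChange
import Literature.AlgebraicTopology.SingularHomology.FundamentalClassExistence
import Mathlib.LinearAlgebra.Dual.Lemmas
import Mathlib.LinearAlgebra.Basis.VectorSpace
import HarnessLib

/-!
# The global invariant cycle theorem: passage from `ℚ`- to `ℂ`-coefficients (proofs, part 2)

Third file of the unit `deligne_globalInvariantCycles` (Deligne, *Hodge II*, Thm. 4.1.1 =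
Voisin II, Thm. 4.24; the named fact lives in `HodgeTheory/GlobalInvariantCycles`, the partial
proofs in `HodgeTheory/GlobalInvariantCyclesProofs`). The printed proof (Voisin II §4.3.3) is the
conjunction of Thm. 4.18 (Deligne 1968: `Hᵏ(𝒳, ℚ) → Hᵏ(X_{s₀}, ℚ)^{inv}` onto) and Prop. 4.23
(`Hᵏ(𝒳, ℚ) → Hᵏ(X_{s₀}, ℚ)` and `Hᵏ(𝒳̄, ℚ) → Hᵏ(X_{s₀}, ℚ)` have the same image; weights and
strictness). `GlobalInvariantCyclesProofs` proved Prop. 4.23 over `ℚ` from Deligne's mixed Hodge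
structures (`Motives.MixedHodgeStructureOfPair`) modulo Hodge II, Cor. 3.2.17
(`exists_bettiCohomology_map_fiberι_eq_of_isQuasiProjectiveOver`), but the carriers of the named
fact are `ℂ`-valued (`complexBetti = Hᵏ(–(ℂ); ℂ)`), and the tree had no comparison
`Hᵏ(–; ℂ) = Hᵏ(–; ℚ) ⊗ ℂ` natural in the space. This file supplies exactly the comparison that is
needed, for arbitrary spaces and WITHOUT finiteness assumptions, and threads it through:

* `range_singularCohomology_map_le_iff_of_field` — over a field `F`, for continuous
  `f : Y → X`, `g : Y → T`: `Im(f^* : Hⁿ(X; F) → Hⁿ(Y; F)) ⊆ Im(g^*)` iff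
  `ker(g_* : Hₙ(Y; F) → Hₙ(T; F)) ⊆ ker(f_*)` (Hatcher Thm. 3.2 / p. 198 and p. 201: over a field
  `Hⁿ = Hom(Hₙ, F)` naturally, the tree's `singularCohomology_map_eq_conj_dualMap_of_field`; and a
  subspace is determined by its annihilator);
* `singularHomology.ker_map_le_ker_map_of_algebra` — the homological condition ASCENDS along a
  field extension `K ⊆ L` (Hatcher §3.A: `Hₙ(X; L) = Hₙ(X; K) ⊗_K L`; proved here by the
  coordinate argument on the tree's concrete chains: w.r.t. a `K`-basis `(bⱼ)` of `L` every class
  `a ∈ Hₙ(Y; L)` is `∑ⱼ bⱼ • (aⱼ ⊗ 1)` for finitely many coordinate classes `aⱼ ∈ Hₙ(Y; K)`,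
  `clocalHomology.exists_eq_sum_smul_coeffMap`, the coordinate and inclusion maps being the tree's
  change-of-coefficient maps `clocalHomology.coeffMap` across the rings `K`, `L`, natural in maps
  of spaces, `clocalHomology.coeffMap_map_apply`);
* `singularCohomology.range_map_le_range_map_of_algebra` — hence **`Im f^* ⊆ Im g^*` over `K`
  implies `Im f^* ⊆ Im g^*` over `L`**;
* `exists_complexBetti_map_fiberι_eq_of_rat` — the input `h423` of
  `deligne_globalInvariantCycles_assembly` (Prop. 4.23 on the `ℂ`-carriers) follows from its
  `ℚ`-form; `exists_complexBetti_map_fiberι_eq_of_mixedHodge` — hence from Deligne's mixed Hodge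
  structures `M` and Hodge II 3.2.17 for `𝒳 ⊆ 𝒳̄`;
* `deligne_globalInvariantCycles_of_thm418_of_cor3217` — **the named fact follows from Voisin II
  Thm. 4.18 (pointwise, `ℂ`-coefficients), a package `M : MixedHodgeStructureOfPair ℂ` of mixed Hodge
  structures (named fact `MixedHodgeStructureOfPair.existsDeligne`) and Hodge II, Cor. 3.2.17 for
  `M`.** What remains open for `deligne_globalInvariantCycles_holds` is exactly these three inputs.

Everything here is proved; no definitions, no new named facts.

## References

* [DeligneHodgeII1971] P. Deligne, Théorie de Hodge II, Publ. Math. IHÉS 40 (1971), Thm. 4.1.1,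
  Cor. 3.2.17, Thm. 2.3.5.
* [VoisinHodgeII2003] C. Voisin, Hodge Theory and Complex Algebraic Geometry II, CUP 2003, §4.3,
  Thm. 4.18, Prop. 4.23, Thm. 4.24.
* [HatcherAT2002] A. Hatcher, Algebraic Topology, CUP 2002, §2.2 p. 153, §3.1 Thm. 3.2, pp. 198,
  201, §3.A Lemma 3A.1, Cor. 3A.4.
-/

noncomputable section

-- as in `SingularChainsConcrete` / `LocalHomologyCoeffChange`: chains of the concrete complex
-- are `Finsupp`s up to unfolding
set_option backward.isDefEq.respectTransparency false

open CategoryTheory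

universe u v v'

namespace Literature.AlgebraicTopology.SingularHomology

/-! ### Over a field: images of `f^*` and kernels of `f_*` -/

section Duality

variable (F : Type v) [Field F] {X Y T : Type u} [TopologicalSpace X] [TopologicalSpace Y]
  [TopologicalSpace T]

/-- Over a field, the image of `f^* : Hⁿ(X; F) → Hⁿ(Y; F)` is the annihilator of
`ker(f_* : Hₙ(Y; F) → Hₙ(X; F))`, transported along the Kronecker isomorphism
`Hⁿ(Y; F) ≅ Hom(Hₙ(Y; F), F)` (Hatcher 2002, §3.1 Thm. 3.2, p. 198, p. 201: `f^*` is the transpose of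
`f_*`; and `Im(φᵀ) = (ker φ)⁰` for vector spaces). [cite: HatcherAT2002, §3.1 Thm. 3.2 (p. 195) and p. 201] -/
theorem range_singularCohomology_map_eq_map_dualAnnihilator_of_field (f : C(Y, X)) (n : ℕ) :
    LinearMap.range (singularCohomology.map F F f n).hom =
      (LinearMap.ker (singularHomology.map F F f n).hom).dualAnnihilator.map
        (LinearEquiv.ofBijective _ (kroneckerPairing_bijective_of_field F Y n)).symm.toLinearMap := by
  rw [singularCohomology_map_eq_conj_dualMap_of_field F f n, LinearMap.range_comp,
    LinearEquiv.range, Submodule.map_top, LinearMap.range_comp,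
    LinearMap.range_dualMap_eq_dualAnnihilator_ker]

/-- **Over a field, `Im f^* ⊆ Im g^*` in `Hⁿ(Y; F)` iff `ker g_* ⊆ ker f_*` in `Hₙ(Y; F)`**, for
continuous `f : Y → X`, `g : Y → T` (Hatcher 2002, §3.1: with field coefficients cohomology is the
dual of homology, naturally; a subspace of a vector space is determined by its annihilator,
Mathlib's `Subspace.dualAnnihilator_le_dualAnnihilator_iff`).
[cite: HatcherAT2002, §3.1 Thm. 3.2 (p. 195) and p. 201] -/
theorem range_singularCohomology_map_le_iff_of_field (f : C(Y, X)) (g : C(Y, T)) (n : ℕ) :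
    LinearMap.range (singularCohomology.map F F f n).hom ≤
        LinearMap.range (singularCohomology.map F F g n).hom ↔
      LinearMap.ker (singularHomology.map F F g n).hom ≤
        LinearMap.ker (singularHomology.map F F f n).hom := by
  rw [range_singularCohomology_map_eq_map_dualAnnihilator_of_field F f n,
    range_singularCohomology_map_eq_map_dualAnnihilator_of_field F g n,
    Submodule.map_le_map_iff_of_injective (LinearEquiv.injective _),
    Subspace.dualAnnihilator_le_dualAnnihilator_iff]

end Duality

/-! ### Absolute homology inside concrete local homology at `univ` -/

section Concrete

variable (R : Type v) [CommRing R] (M : Type v) [AddCommGroup M] [Module R M]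
variable {X Y T : Type u} [TopologicalSpace X] [TopologicalSpace Y] [TopologicalSpace T]

omit [TopologicalSpace X] [TopologicalSpace Y] in
/-- Every map is a map of pairs `(X, X ∖ X) → (Y, Y ∖ Y)`. [folklore] -/
theorem mapsTo_compl_univ (f : X → Y) : Set.MapsTo f (Set.univ : Set X)ᶜ (Set.univ : Set Y)ᶜ :=
  fun _ hx ↦ (hx (Set.mem_univ _)).elim

/-- **Naturality of `Hₙ(X; M) → Hₙ(X | X; M)`** (Mathlib's singular homology to the concrete local
homology at `univ`, `c ↦ [π (compIso⁻¹ c)]`): it commutes with the maps induced by a continuous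
`f : X → Y` (Hatcher 2002, §2.1, naturality of `j_*`). [cite: HatcherAT2002, §2.1] -/
theorem homologyMap_π_compIso_inv_map (f : C(X, Y)) (n : ℕ) (c : singularHomology R M X n) :
    HomologicalComplex.homologyMap (awaySub R M Y Set.univ).π n
        ((csingularHomology.compIso R M Y n).inv (singularHomology.map R M f n c)) =
      clocalHomology.map R M f (mapsTo_compl_univ f) n
        (HomologicalComplex.homologyMap (awaySub R M X Set.univ).π n
          ((csingularHomology.compIso R M X n).inv c)) := by
  have h1 : (csingularHomology.compIso R M Y n).inv (singularHomology.map R M f n c) =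
      csingularHomology.map R M f n ((csingularHomology.compIso R M X n).inv c) := by
    rw [csingularHomology.map_eq_conj, ModuleCat.comp_apply, ModuleCat.comp_apply,
      ← ModuleCat.comp_apply (csingularHomology.compIso R M X n).inv, Iso.inv_hom_id,
      ModuleCat.id_apply]
  have h2 : csingularHomology.map R M f n ≫
      HomologicalComplex.homologyMap (awaySub R M Y Set.univ).π n =
        HomologicalComplex.homologyMap (awaySub R M X Set.univ).π n ≫
          clocalHomology.map R M f (mapsTo_compl_univ f) n := by
    rw [clocalHomology.map, csingularHomology.map, ← HomologicalComplex.homologyMap_comp,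
      ← HomologicalComplex.homologyMap_comp, Subcomplex.π_quotMap]
  rw [h1]
  have h3 := congrArg (fun φ ↦ φ ((csingularHomology.compIso R M X n).inv c)) h2
  simpa only [ModuleCat.comp_apply] using h3

/-- `Hₙ(X; M) → Hₙ(X | X; M)`, `c ↦ [π (compIso⁻¹ c)]`, is bijective: it is `j_*` for the pair
`(X, ∅)` (an isomorphism, Hatcher 2002, §2.1: `Hₙ(X, ∅) = Hₙ(X)`) followed by the comparison of the
two models of relative homology (`localHomologyOfSet.cmpIso`). [cite: HatcherAT2002, §2.1] -/
theorem bijective_homologyMap_π_compIso_inv (n : ℕ) :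
    Function.Bijective fun c : singularHomology R M X n ↦
      HomologicalComplex.homologyMap (awaySub R M X Set.univ).π n
        ((csingularHomology.compIso R M X n).inv c) := by
  have h : (fun c : singularHomology R M X n ↦
      HomologicalComplex.homologyMap (awaySub R M X Set.univ).π n
        ((csingularHomology.compIso R M X n).inv c)) =
      ⇑(singularHomology.toLocalOfSet R M X Set.univ n ≫
        (localHomologyOfSet.cmpIso R M X Set.univ n).hom) := by
    funext c
    rw [ModuleCat.comp_apply]
    exact (localHomologyOfSet.cmpIso_hom_toLocalOfSet R M Set.univ n c).symm
  rw [h]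
  haveI : IsEmpty ((Set.univ : Set X)ᶜ : Set X) := ⟨fun x ↦ x.2 (Set.mem_univ _)⟩
  haveI : IsIso (singularHomology.toLocalOfSet R M X Set.univ n) :=
    relativeSingularHomology.isIso_ofAbsolute_of_isEmpty R M (X := X) (Set.univ : Set X)ᶜ n
  exact ConcreteCategory.bijective_of_isIso _

end Concrete

/-! ### Change of coefficients on concrete local homology: naturality and coordinates -/

section CoeffChange

variable {R : Type v} [CommRing R] {R' : Type v'} [CommRing R']
variable {A : Type v} [AddCommGroup A] [Module R A] {A' : Type v'} [AddCommGroup A'] [Module R' A']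
variable {X Y T : Type u} [TopologicalSpace X] [TopologicalSpace Y] [TopologicalSpace T]

/-- **Change of coefficients commutes with induced maps** `f_* : Hᵢ(X | B) → Hᵢ(Y | B')` of maps of
pairs (Hatcher 2002, §2.2 p. 153: the coefficient homomorphism is natural; on representatives,
`g ∘ (f♯ z) = f♯ (g ∘ z)`). [cite: HatcherAT2002, §2.2 p. 153] -/
theorem clocalHomology.coeffMap_map_apply (g : A →+ A') {B : Set X} {B' : Set Y} (f : C(X, Y))
    (hf : Set.MapsTo f Bᶜ B'ᶜ) (i : ℕ) (a : clocalHomology R A X B i) :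
    clocalHomology.coeffMap R R' g B' i (clocalHomology.map R A f hf i a) =
      clocalHomology.map R' A' f hf i (clocalHomology.coeffMap R R' g B i a) := by
  obtain ⟨z, hz, rfl⟩ := (awaySub R A X B).relCls_surjective a
  rw [clocalHomology.map, Subcomplex.homologyMap_quotMap_relCls, clocalHomology.coeffMap_relCls,
    clocalHomology.coeffMap_relCls, clocalHomology.map, Subcomplex.homologyMap_quotMap_relCls]
  refine (awaySub R' A' Y B').relCls_congr ?_ _ _
  rw [csingularChainComplex.map_f_apply, csingularChainComplex.map_f_apply]
  exact (Finsupp.mapDomain_mapRange _ _ g (map_zero g) (map_add g)).symm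

/-- Change of coefficients along a finite sum of additive maps is the sum. [folklore] -/
theorem clocalHomology.coeffMap_finset_sum {ι : Type*} (s : Finset ι) (g : ι → (A →+ A'))
    (B : Set X) (i : ℕ) :
    clocalHomology.coeffMap R R' (∑ j ∈ s, g j) B i = ∑ j ∈ s, clocalHomology.coeffMap R R' (g j) B i := by
  classical
  induction s using Finset.induction_on with
  | empty => rw [Finset.sum_empty, Finset.sum_empty, clocalHomology.coeffMap_zero]
  | insert j s hj ih => rw [Finset.sum_insert hj, Finset.sum_insert hj, clocalHomology.coeffMap_add, ih]

variable (K : Type v) {L : Type v} [Field K] [Field L] [Algebra K L]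

/-- **Coordinates of a homology class with coefficients in a field extension.** For a `K`-basis
`(bⱼ)` of `L`, every `a ∈ Hᵢ(X | B; L)` is `∑_{j ∈ s} bⱼ • ι_*((bⱼ^∨)_* a)` for a finite set `s` of
indices, where `(bⱼ^∨)_* : Hᵢ(X | B; L) → Hᵢ(X | B; K)` and `ι_* : Hᵢ(X | B; K) → Hᵢ(X | B; L)` are the
changes of coefficients along the coordinate functional `bⱼ^∨ : L → K` and the inclusion
`ι : K → L` (a representing chain has finitely many coefficients, each with finitely many
non-zero coordinates; Hatcher 2002, §3.A: `Cₙ(X; L) = Cₙ(X; K) ⊗_K L`). [cite: HatcherAT2002, §3.A Lemma 3A.1] -/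
theorem clocalHomology.exists_eq_sum_smul_coeffMap {ι : Type*} (b : Module.Basis ι K L)
    (B : Set X) (i : ℕ) (a : clocalHomology L L X B i) :
    ∃ s : Finset ι, a = ∑ j ∈ s, b j •
      clocalHomology.coeffMap K L (Algebra.linearMap K L).toAddMonoidHom B i
        (clocalHomology.coeffMap L K (b.coord j).toAddMonoidHom B i a) := by
  classical
  obtain ⟨z, hz, rfl⟩ := (awaySub L L X B).relCls_surjective a
  -- the representing relative cycle as a finitely supported function
  let w : CChain L X i := z
  refine ⟨w.support.biUnion fun σ ↦ (b.repr (w σ)).support, ?_⟩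
  set s : Finset ι := w.support.biUnion fun σ ↦ (b.repr (w σ)).support with hs
  -- the additive projector `P = ∑_{j ∈ s} bⱼ • ι ∘ bⱼ^∨` of `L`
  let G : ι → (L →+ L) := fun j ↦ (DistribSMul.toAddMonoidHom L (b j)).comp
    ((Algebra.linearMap K L).toAddMonoidHom.comp (b.coord j).toAddMonoidHom)
  have hterm : ∀ j, b j • clocalHomology.coeffMap K L (Algebra.linearMap K L).toAddMonoidHom B i
      (clocalHomology.coeffMap L K (b.coord j).toAddMonoidHom B i ((awaySub L L X B).relCls z hz)) =
      clocalHomology.coeffMap L L (G j) B i ((awaySub L L X B).relCls z hz) := by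
    intro j
    rw [clocalHomology.coeffMap_comp_apply (R' := L), clocalHomology.coeffMap_smul_apply,
      clocalHomology.coeffMap_comp_apply (R' := K)]
  rw [Finset.sum_congr rfl fun j _ ↦ hterm j, ← AddMonoidHom.finsetSum_apply,
    ← clocalHomology.coeffMap_finset_sum, clocalHomology.coeffMap_relCls]
  refine (awaySub L L X B).relCls_congr ?_ _ _
  -- `z = P ∘ z` coefficientwise
  have key : ∀ x : L, (b.repr x).support ⊆ s → (∑ j ∈ s, G j) x = x := by
    intro x hx
    rw [AddMonoidHom.finsetSum_apply]
    calc ∑ j ∈ s, G j x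
        = ∑ j ∈ s, (b.repr x j) • b j :=
          Finset.sum_congr rfl fun j _ ↦ by
            change b j • algebraMap K L (b.coord j x) = _
            rw [Module.Basis.coord_apply, smul_eq_mul, mul_comm, ← Algebra.smul_def]
      _ = Finsupp.linearCombination K b (b.repr x) := by
          rw [Finsupp.linearCombination_apply]
          exact (Finsupp.sum_of_support_subset _ hx (fun j c ↦ c • b j)
            fun j _ ↦ zero_smul K (b j)).symm
      _ = x := b.linearCombination_repr x
  change w = Finsupp.mapRange _ _ w
  refine Finsupp.ext fun σ ↦ ?_
  rw [Finsupp.mapRange_apply]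
  by_cases hσ : σ ∈ w.support
  · exact (key (w σ) (Finset.subset_biUnion_of_mem (fun σ ↦ (b.repr (w σ)).support) hσ)).symm
  · rw [Finsupp.notMem_support_iff.1 hσ, map_zero]

/-- **Vanishing under `f_*` modulo vanishing under `g_*` ascends along field extensions** (concrete
local homology): if over `K` every class killed by `g_*` is killed by `f_*`, the same holds over
`L ⊇ K` — expand an `L`-class in coordinates (`exists_eq_sum_smul_coeffMap`); the coordinate classes
of a class killed by `g_*` are killed by `g_*` (naturality `coeffMap_map_apply`), hence by `f_*`.
[cite: HatcherAT2002, §3.A Lemma 3A.1 and Cor. 3A.4] -/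
theorem clocalHomology.map_eq_zero_of_algebra {A₀ : Set X} {B : Set Y} {C : Set T}
    (f : C(Y, X)) (g : C(Y, T)) (hf : Set.MapsTo f Bᶜ A₀ᶜ) (hg : Set.MapsTo g Bᶜ Cᶜ) (i : ℕ)
    (hK : ∀ a : clocalHomology K K Y B i,
      clocalHomology.map K K g hg i a = 0 → clocalHomology.map K K f hf i a = 0)
    (a : clocalHomology L L Y B i) (ha : clocalHomology.map L L g hg i a = 0) :
    clocalHomology.map L L f hf i a = 0 := by
  obtain ⟨s, hs⟩ := clocalHomology.exists_eq_sum_smul_coeffMap K (Module.Basis.ofVectorSpace K L) B i a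
  rw [hs, map_sum]
  refine Finset.sum_eq_zero fun j _ ↦ ?_
  rw [map_smul, ← clocalHomology.coeffMap_map_apply, hK _ ?_, map_zero, smul_zero]
  rw [← clocalHomology.coeffMap_map_apply, ha, map_zero]

/-- **`ker g_* ⊆ ker f_*` ascends along field extensions** (singular homology): for continuous
`f : Y → X`, `g : Y → T` and fields `K ⊆ L`, if `ker(g_*) ⊆ ker(f_*)` on `Hₙ(Y; K)` then
`ker(g_*) ⊆ ker(f_*)` on `Hₙ(Y; L)` (Hatcher 2002, §3.A: `Hₙ(–; L) = Hₙ(–; K) ⊗_K L` naturally;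
here via the concrete model, `clocalHomology.map_eq_zero_of_algebra`).
[cite: HatcherAT2002, §3.A Lemma 3A.1 and Cor. 3A.4] -/
theorem singularHomology.ker_map_le_ker_map_of_algebra (f : C(Y, X)) (g : C(Y, T)) (n : ℕ)
    (hK : LinearMap.ker (singularHomology.map K K g n).hom ≤
      LinearMap.ker (singularHomology.map K K f n).hom) :
    LinearMap.ker (singularHomology.map L L g n).hom ≤
      LinearMap.ker (singularHomology.map L L f n).hom := by
  intro c hc
  rw [LinearMap.mem_ker] at hc ⊢
  change singularHomology.map L L f n c = 0
  change singularHomology.map L L g n c = 0 at hc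
  apply (bijective_homologyMap_π_compIso_inv L L (X := X) n).1
  change HomologicalComplex.homologyMap (awaySub L L X Set.univ).π n
      ((csingularHomology.compIso L L X n).inv (singularHomology.map L L f n c)) =
    HomologicalComplex.homologyMap (awaySub L L X Set.univ).π n
      ((csingularHomology.compIso L L X n).inv 0)
  rw [map_zero, map_zero, homologyMap_π_compIso_inv_map]
  refine clocalHomology.map_eq_zero_of_algebra K f g (mapsTo_compl_univ f) (mapsTo_compl_univ g) n
    ?_ _ ?_
  · intro a ha
    obtain ⟨a₀, rfl⟩ := (bijective_homologyMap_π_compIso_inv K K (X := Y) n).2 a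
    beta_reduce at ha ⊢
    rw [← homologyMap_π_compIso_inv_map] at ha ⊢
    have hg0 : singularHomology.map K K g n a₀ = 0 := by
      apply (bijective_homologyMap_π_compIso_inv K K (X := T) n).1
      beta_reduce
      rw [ha, map_zero, map_zero]
    have hf0 : singularHomology.map K K f n a₀ = 0 :=
      LinearMap.mem_ker.1 (hK (LinearMap.mem_ker.2 hg0))
    rw [hf0, map_zero, map_zero]
  · rw [← homologyMap_π_compIso_inv_map, hc, map_zero, map_zero]

/-- **`Im f^* ⊆ Im g^*` ascends along field extensions** (singular cohomology): for continuous
`f : Y → X`, `g : Y → T` and fields `K ⊆ L`, if `Im(f^* : Hⁿ(X; K) → Hⁿ(Y; K)) ⊆ Im(g^*)` then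
`Im(f^* : Hⁿ(X; L) → Hⁿ(Y; L)) ⊆ Im(g^*)` — over each field this is `ker g_* ⊆ ker f_*`
(`range_singularCohomology_map_le_iff_of_field`), which ascends
(`singularHomology.ker_map_le_ker_map_of_algebra`). The universal-coefficient comparison
`Hⁿ(–; L) = Hⁿ(–; K) ⊗_K L` in the form needed below (Hatcher 2002, §3.1, §3.A).
[cite: HatcherAT2002, §3.1 Thm. 3.2 (p. 195) and §3.A Cor. 3A.4] -/
theorem singularCohomology.range_map_le_range_map_of_algebra (f : C(Y, X)) (g : C(Y, T)) (n : ℕ)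
    (hK : LinearMap.range (singularCohomology.map K K f n).hom ≤
      LinearMap.range (singularCohomology.map K K g n).hom) :
    LinearMap.range (singularCohomology.map L L f n).hom ≤
      LinearMap.range (singularCohomology.map L L g n).hom := by
  rw [range_singularCohomology_map_le_iff_of_field] at hK ⊢
  exact singularHomology.ker_map_le_ker_map_of_algebra K f g n hK

end CoeffChange

end Literature.AlgebraicTopology.SingularHomology

/-! ### Prop. 4.23 on the `ℂ`-carriers, and the named fact from Thm. 4.18 + mixed Hodge structures + 3.2.17 -/

namespace Literature.AlgebraicGeometry.HodgeTheory

open _root_.AlgebraicGeometry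
open Literature.AlgebraicTopology.SingularHomology
open Literature.AlgebraicGeometry.Motives

section Schemes

variable {𝒳 Xbar S : Motives.SchemeOver ℂ}

/-- **Prop. 4.23 on the `ℂ`-carriers from its `ℚ`-form.** If every class of `Hᵏ(𝒳(ℂ); ℚ)` has the
same restriction to the fibre `𝒳_{s₀}` as some class of `Hᵏ(𝒳̄(ℂ); ℚ)` (pull-back along
`i : 𝒳 ⟶ 𝒳̄`; the conclusion of `exists_bettiCohomology_map_fiberι_eq`), then the same holds with
`ℂ`-coefficients, i.e. the input `h423` of `deligne_globalInvariantCycles_assembly` (naturality of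
`SchemePair.absIso`, the tree's `absIso_hom_map_ofScheme`, and
`singularCohomology.range_map_le_range_map_of_algebra` for `ℚ ⊆ ℂ`: "`Hᵏ(X, ℂ) = Hᵏ(X, ℚ) ⊗ ℂ`").
[cite: VoisinHodgeII2003, Prop. 4.23] [cite: HatcherAT2002, §3.A Cor. 3A.4] -/
theorem exists_complexBetti_map_fiberι_eq_of_rat (f : 𝒳 ⟶ S) (i : 𝒳 ⟶ Xbar) (k : ℕ)
    (s₀ : Motives.ComplexPoints S)
    (hQ : ∀ β : SchemePair.bettiCohomology (SchemePair.ofScheme 𝒳) k,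
      ∃ A : SchemePair.bettiCohomology (SchemePair.ofScheme Xbar) k,
        SchemePair.bettiCohomology.map (SchemePair.Hom.ofScheme (Motives.fiberι f s₀)) k β =
          SchemePair.bettiCohomology.map (SchemePair.Hom.ofScheme (Motives.fiberι f s₀ ≫ i)) k A)
    (β : complexBetti 𝒳 k) :
    ∃ A : complexBetti Xbar k,
      complexBetti.map (Motives.fiberι f s₀) k β = complexBetti.map (Motives.fiberι f s₀ ≫ i) k A := by
  have hQ' : LinearMap.range (singularCohomology.map ℚ ℚ
        (Motives.AlgPoints.mapContinuous (L := ℂ) (Motives.fiberι f s₀)) k).hom ≤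
      LinearMap.range (singularCohomology.map ℚ ℚ
        (Motives.AlgPoints.mapContinuous (L := ℂ) (Motives.fiberι f s₀ ≫ i)) k).hom := by
    rintro _ ⟨x, rfl⟩
    obtain ⟨A, hA⟩ := hQ ((SchemePair.absIso 𝒳 k).inv x)
    refine ⟨(SchemePair.absIso Xbar k).hom A, ?_⟩
    have h1 := absIso_hom_map_ofScheme (Motives.fiberι f s₀ ≫ i) k A
    have h2 := absIso_hom_map_ofScheme (Motives.fiberι f s₀) k ((SchemePair.absIso 𝒳 k).inv x)
    have hx : (SchemePair.absIso 𝒳 k).hom ((SchemePair.absIso 𝒳 k).inv x) = x := by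
      rw [← ModuleCat.comp_apply, Iso.inv_hom_id, ModuleCat.id_apply]
    rw [hx] at h2
    rw [← hA, h2] at h1
    exact h1.symm
  obtain ⟨A, hA⟩ :=
    singularCohomology.range_map_le_range_map_of_algebra ℚ (L := ℂ) _ _ k hQ' ⟨β, rfl⟩
  exact ⟨A, hA.symm⟩

/-- **Prop. 4.23 on the `ℂ`-carriers from Deligne's mixed Hodge structures and Hodge II 3.2.17**:
for a smooth projective family `f : 𝒳 ⟶ S` over a quasi-projective `S`, `i : 𝒳 ⟶ 𝒳̄`, a package `M`
of mixed Hodge structures on the rational cohomology of `ℂ`-varieties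
(`Motives.MixedHodgeStructureOfPair ℂ`) and Cor. 3.2.17 for `M` and `i` in degree `k` (`h3217`:
`W_k Hᵏ(𝒳; ℚ) ⊆ Im i^*`), every class of `Hᵏ(𝒳(ℂ); ℂ)` has the same restriction to `𝒳_{s₀}` as a class
of `Hᵏ(𝒳̄(ℂ); ℂ)` — the input `h423` of `deligne_globalInvariantCycles_assembly`
(`exists_bettiCohomology_map_fiberι_eq_of_isQuasiProjectiveOver` + `exists_complexBetti_map_fiberι_eq_of_rat`).
[cite: VoisinHodgeII2003, Prop. 4.23] [cite: DeligneHodgeII1971, Théorème 4.1.1 and Cor. 3.2.17] -/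
theorem exists_complexBetti_map_fiberι_eq_of_mixedHodge (M : MixedHodgeStructureOfPair ℂ)
    (f : 𝒳 ⟶ S) (i : 𝒳 ⟶ Xbar) {n : ℕ} (hf : IsSmoothProjectiveFamily f n)
    (hS : IsQuasiProjectiveOver S) (k : ℕ) (s₀ : Motives.ComplexPoints S)
    (h3217 : (M.mhs (SchemePair.ofScheme 𝒳) k).W k ≤
      LinearMap.range (SchemePair.bettiCohomology.map (SchemePair.Hom.ofScheme i) k).hom)
    (β : complexBetti 𝒳 k) :
    ∃ A : complexBetti Xbar k,
      complexBetti.map (Motives.fiberι f s₀) k β = complexBetti.map (Motives.fiberι f s₀ ≫ i) k A :=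
  exists_complexBetti_map_fiberι_eq_of_rat f i k s₀
    (exists_bettiCohomology_map_fiberι_eq_of_isQuasiProjectiveOver M f i hf hS k s₀ h3217) β

/-- **The global invariant cycle theorem from its three published inputs.** The named fact
`deligne_globalInvariantCycles` (Deligne, Hodge II, Thm. 4.1.1; Voisin II, Thm. 4.24) follows from:
* `h418` — Voisin II, Thm. 4.18 (Deligne 1968: degeneration of the Leray spectral sequence of a
  smooth projective family, with Lemma 4.17), in the pointwise form on the real carriers: for a smooth
  projective family `f : 𝒳 ⟶ S` over a smooth quasi-projective `S`, every value `σ(s₀)` of a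
  continuous section `σ` of `FiberClass.pt` (a global section of `Rᵏ f_* ℂ`) is the restriction of a
  class of `Hᵏ(𝒳(ℂ); ℂ)`;
* `M` — mixed Hodge structures on the rational cohomology of complex varieties, functorial and pure
  on smooth projective ones (Deligne, Hodge II–III; the named fact
  `Motives.MixedHodgeStructureOfPair.existsDeligne`);
* `h3217` — Hodge II, Cor. 3.2.17 for `M`: for an open immersion `i : 𝒳 ⟶ 𝒳̄` into a smooth
  projective `𝒳̄`, `W_k Hᵏ(𝒳; ℚ) ⊆ Im(i^* : Hᵏ(𝒳̄; ℚ) → Hᵏ(𝒳; ℚ))`;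
by strictness of morphisms of mixed Hodge structures (PROVED in the tree, `Hom.map_W_eq`), the
`ℚ → ℂ` comparison of this file, and the assembly `deligne_globalInvariantCycles_assembly` — exactly
the architecture of the printed proof ("This result [Prop. 4.23] combines with theorem 4.18 to give
the global invariant cycles theorem"). [cite: DeligneHodgeII1971, Théorème 4.1.1]
[cite: VoisinHodgeII2003, Thm. 4.18, Prop. 4.23 and Thm. 4.24] -/
theorem deligne_globalInvariantCycles_of_thm418_of_cor3217
    (h418 : ∀ (𝒳 S : Motives.SchemeOver ℂ) (f : 𝒳 ⟶ S) (n : ℕ),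
      IsSmoothProjectiveFamily f n → IsQuasiProjectiveOver S → Smooth S.hom →
      ∀ (k : ℕ) (σ : Motives.ComplexPoints S → FiberClass f k), Continuous σ → (∀ s, (σ s).pt = s) →
        ∀ s₀ : Motives.ComplexPoints S, ∃ β : complexBetti 𝒳 k, σ s₀ = globalSection f k β s₀)
    (M : MixedHodgeStructureOfPair ℂ)
    (h3217 : ∀ (𝒳 Xbar : Motives.SchemeOver ℂ) (i : 𝒳 ⟶ Xbar) (m : ℕ),
      IsProjectiveOver Xbar → SmoothOfRelativeDimension m Xbar.hom → IsOpenImmersion i.left →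
      ∀ k : ℕ, (M.mhs (SchemePair.ofScheme 𝒳) k).W k ≤
        LinearMap.range (SchemePair.bettiCohomology.map (SchemePair.Hom.ofScheme i) k).hom) :
    deligne_globalInvariantCycles := by
  intro 𝒳 Xbar S f i n m hf hS hSs hXbar hXs hi k σ hσ hpt s₀
  exact deligne_globalInvariantCycles_assembly f i k σ s₀ (h418 𝒳 S f n hf hS hSs k σ hσ hpt s₀)
    (exists_complexBetti_map_fiberι_eq_of_mixedHodge M f i hf hS k s₀ (h3217 𝒳 Xbar i m hXbar hXs hi k))

end Schemes

end Literature.AlgebraicGeometry.HodgeTheory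

end
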